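import Summits.Ventures.Crystal3D.Theorems.StickyWulffConstantGenericWallFloorSigma9Cross
import Summits.Ventures.Crystal3D.Theorems.StickyWulffConstantGenericWallFloorInPlaneTwinStarPair
import Summits.Ventures.Crystal3D.Theorems.StickyWulffConstantGenericWallFloorStackLedgerCross
import Summits.Ventures.Crystal3D.Theorems.StickyWulffConstantGenericWallFloorAtHalf
import HarnessLib

/-!
# `GenericWallFloor` at FULL charge `c₀ = 1` on the one-sided `Σ9` class, modulo three named stars-only inputs
# (crux `GenericWallFloor`, stmt-Ventures-19480, line `WallLedgerG`)

HONEST FRAMING. Venture `Summits/Ventures/Crystal3D` (cell `crystal3d-full`), helper `--supports` the crux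
`GenericWallFloor` of `route-Ventures-StickyWulffConstant`, REGISTERED line `WallLedgerG`, open stub
`stub_twoSlabAdhesion`.  Rung credit only; F-C1 not moved; NOT the crux: the inputs `ExactOnly`(C12-55) [E1, certified],
`StarPairFar` [certified ×2] and the NEW `InPlaneTwinStarPair` [uncertified, `…InPlaneTwinStarPair`] remain BY NAME.

**`genericWallFloorAtCharge_one_sigma9_of_far`.**  For a `Σ9` pair `A₂·Λ₀ = (wordFrame A₁ [μk, μk1])·Λ₀` (reduced
two-letter model menu word), a steep up-slot `u₁` of grain 1 IN the first mirror plane (`⟪u₁, μk1⟫ = 0`), any steep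
down-slot `u₂` of grain 2, and the level-two condition on grain 2's downward forced ray in its two readings
(`hsecond`: the lamella's best capper does not force the first mirror next; `hcap`: that capper lies in the first
mirror plane): `GenericWallFloorAtCharge 1 A₁ t₁ A₂ t₂` — the matrix of the route decl for the pair, verbatim, at the
crux's own constant.  This is the ray-ALIGNED part of the `Σ9` core one side of which is word-separated: by
`inPlaneTwin_of_coaxial_sigma9` its only co-axial cross pair of walker tops is the in-plane twin pair, priced by
`InPlaneTwinStarPair` inside the separation-free ledger `twoSlabAdhesion_stackLedger_cross`; arrivals are excluded on
both sides by the word analysis (`image_ne_of_word`, `image_ne_bottom_of_sigma9`).  Numerically (seat folder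
`calc/onesided2.py`) the class «some steep slot of one grain in its composition plane AND the other grain's forced ray
missing the first lattice» is `≈ 82 %` of Haar `Σ9` orientations (full-charge coverage before this file: the two-sided
word criterion, `39 %`).
WHAT THIS IS NOT: not the stub; `InPlaneTwinStarPair` is an uncertified input (lit's stars-only certifier or a hand
proof can discharge it); the mutual-arrival residual of the core is untouched; F-C1 not moved.
-/

noncomputable section

namespace Summit.Ventures.Crystal3D.Theorems

open Summit.Ventures.Crystal3D Finset
open Literature.MathematicalPhysics.StatisticalMechanics (fccStacking barlowStacking IsHaggSeq contactDeficiency)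
open scoped InnerProductSpace

/-- A mirror twin about a unit menu normal MOVES the lattice. -/
theorem image_twinFrame_ne (A : EuclideanSpace ℝ (Fin 3) ≃ₗᵢ[ℝ] EuclideanSpace ℝ (Fin 3)) {ν : EuclideanSpace ℝ (Fin 3)}
    (hν : ‖ν‖ = 1)
    (hmenu : ∀ w ∈ fccSlots, ⟪A w, ν⟫_ℝ = 0 ∨ ⟪A w, ν⟫_ℝ = Real.sqrt (2 / 3) ∨ ⟪A w, ν⟫_ℝ = -Real.sqrt (2 / 3)) :
    twinFrame A ν '' fccStacking 1 (Real.sqrt (2 / 3)) ≠ A '' fccStacking 1 (Real.sqrt (2 / 3)) := by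
  intro hEq
  set μ := A.symm ν with hμ
  have hμu : ‖μ‖ = 1 := by rw [hμ, LinearIsometryEquiv.norm_map, hν]
  have hμm : ∀ w ∈ fccSlots, ⟪w, μ⟫_ℝ = 0 ∨ ⟪w, μ⟫_ℝ = Real.sqrt (2 / 3) ∨ ⟪w, μ⟫_ℝ = -Real.sqrt (2 / 3) := by
    intro w hw
    rw [hμ, ← LinearIsometryEquiv.inner_map_map A, LinearIsometryEquiv.apply_symm_apply]
    exact hmenu w hw
  have htw : twinFrame A ν = wordFrame A [μ] := by rw [twinFrame_eq_reflection_trans A hν]; rfl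
  have himg := image_fccSlots_eq_of_image_fcc_eq _ _ hEq
  rw [htw, show (A : EuclideanSpace ℝ (Fin 3) → EuclideanSpace ℝ (Fin 3)) = (wordFrame A [] : _ → _) from rfl] at himg
  have hmap := map_reflection_eq_of_image_eq A (κ := [μ]) (κ' := [])
    (fun μ' hμ' => by rw [List.mem_singleton] at hμ'; rw [hμ']; exact ⟨hμu, hμm⟩) (List.isChain_singleton _)
    (fun _ h => by simp at h) List.isChain_nil himg
  simp at hmap

open scoped Classical in
/-- **`GenericWallFloor` per pair at FULL charge on the one-sided `Σ9` class**, modulo `ExactOnly`(C12-55), `StarPairFar`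
and `InPlaneTwinStarPair`.  See the module docstring. -/
theorem genericWallFloorAtCharge_one_sigma9_of_far
    {s₀ : EuclideanSpace ℝ (Fin 3)} (hs₀ : s₀ ∈ fccSlots)
    (hcert : ExactOnly 0 (fccSlots.filter fun w => 0 < ⟪w, s₀⟫_ℝ)) (hfar : StarPairFar) (htw : InPlaneTwinStarPair)
    (A₁ : EuclideanSpace ℝ (Fin 3) ≃ₗᵢ[ℝ] EuclideanSpace ℝ (Fin 3)) (t₁ : EuclideanSpace ℝ (Fin 3))
    (A₂ : EuclideanSpace ℝ (Fin 3) ≃ₗᵢ[ℝ] EuclideanSpace ℝ (Fin 3)) (t₂ : EuclideanSpace ℝ (Fin 3))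
    {u₁ : EuclideanSpace ℝ (Fin 3)} (hu₁ : u₁ ∈ fccSlots)
    (hsteep₁ : Real.sqrt 2 / 2 ≤ ⟪A₁ u₁, EuclideanSpace.single (2 : Fin 3) (1 : ℝ)⟫_ℝ)
    {u₂ : EuclideanSpace ℝ (Fin 3)} (hu₂ : u₂ ∈ fccSlots)
    (hsteep₂ : ⟪A₂ u₂, EuclideanSpace.single (2 : Fin 3) (1 : ℝ)⟫_ℝ ≤ -(Real.sqrt 2 / 2))
    (μk μk1 : EuclideanSpace ℝ (Fin 3))
    (hκl : ∀ μ ∈ [μk, μk1], ‖μ‖ = 1 ∧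
      ∀ w ∈ fccSlots, ⟪w, μ⟫_ℝ = 0 ∨ ⟪w, μ⟫_ℝ = Real.sqrt (2 / 3) ∨ ⟪w, μ⟫_ℝ = -Real.sqrt (2 / 3))
    (hκc : List.IsChain (fun μ μ' => ⟪μ, μ'⟫_ℝ = 1 / 3 ∨ ⟪μ, μ'⟫_ℝ = -1 / 3) [μk, μk1])
    (hA₂ : A₂ '' fccStacking 1 (Real.sqrt (2 / 3)) = (wordFrame A₁ [μk, μk1]) '' fccStacking 1 (Real.sqrt (2 / 3)))
    (hfirst : ⟪u₁, μk1⟫_ℝ = 0)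
    (hsecond : ∀ n₁ : EuclideanSpace ℝ (Fin 3),
      (n₁ = wordFrame A₁ [μk, μk1] μk ∨ n₁ = -wordFrame A₁ [μk, μk1] μk) → ⟪A₂ u₂, n₁⟫_ℝ = Real.sqrt (2 / 3) →
      ∀ q ∈ fccSlots, 0 < ⟪twinFrame A₂ n₁ q, n₁⟫_ℝ →
        (∀ q' ∈ fccSlots, 0 < ⟪twinFrame A₂ n₁ q', n₁⟫_ℝ →
          ⟪twinFrame A₂ n₁ q', -EuclideanSpace.single (2 : Fin 3) (1 : ℝ)⟫_ℝ ≤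
            ⟪twinFrame A₂ n₁ q, -EuclideanSpace.single (2 : Fin 3) (1 : ℝ)⟫_ℝ) →
        (wordFrame A₁ [μk, μk1]).symm (A₂ ((twinFrame A₂ n₁).symm ((2 * Real.sqrt (2 / 3)) • twinFrame A₂ n₁ q - n₁))) ≠ μk1 ∧
        (wordFrame A₁ [μk, μk1]).symm (A₂ ((twinFrame A₂ n₁).symm ((2 * Real.sqrt (2 / 3)) • twinFrame A₂ n₁ q - n₁))) ≠ -μk1)
    (hcap : ∀ n₁ : EuclideanSpace ℝ (Fin 3),
      (n₁ = wordFrame A₁ [μk, μk1] μk ∨ n₁ = -wordFrame A₁ [μk, μk1] μk) → ⟪A₂ u₂, n₁⟫_ℝ = Real.sqrt (2 / 3) →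
      ∀ q ∈ fccSlots, 0 < ⟪twinFrame A₂ n₁ q, n₁⟫_ℝ →
        (∀ q' ∈ fccSlots, 0 < ⟪twinFrame A₂ n₁ q', n₁⟫_ℝ →
          ⟪twinFrame A₂ n₁ q', -EuclideanSpace.single (2 : Fin 3) (1 : ℝ)⟫_ℝ ≤
            ⟪twinFrame A₂ n₁ q, -EuclideanSpace.single (2 : Fin 3) (1 : ℝ)⟫_ℝ) →
        ⟪twinFrame A₂ n₁ q, A₁ μk1⟫_ℝ = 0) :
    GenericWallFloorAtCharge 1 A₁ t₁ A₂ t₂ := by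
  set e₃ : EuclideanSpace ℝ (Fin 3) := EuclideanSpace.single (2 : Fin 3) (1 : ℝ) with he₃
  have hκ2 : 2 ≤ [μk, μk1].length := by simp
  have hfirst' : ∀ μ, [μk, μk1].getLast? = some μ → ⟪u₁, μ⟫_ℝ = 0 := fun μ hμ => by
    simp at hμ; rw [← hμ]; exact hfirst
  have hsteep₂' : Real.sqrt 2 / 2 ≤ ⟪A₂ u₂, -e₃⟫_ℝ := by rw [inner_neg_right]; linarith only [hsteep₂]
  -- the trivial grain-1 stack
  have hS₀ : StackSound e₃ [⟨A₁, u₁, 0⟩] := ⟨hu₁, hsteep₁⟩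
  have hW₀ : StackWF e₃ [⟨A₁, u₁, 0⟩] := rfl
  -- (a) no grain-1 stack frame is `A₂·Λ₀`
  have hfar₁ : ∀ stk : List WalkEntry, StackSound e₃ stk → StackWF e₃ stk → stk.getLast? = some ⟨A₁, u₁, 0⟩ →
      ∀ e ∈ stk, e.frame '' fccStacking 1 (Real.sqrt (2 / 3)) ≠ A₂ '' fccStacking 1 (Real.sqrt (2 / 3)) :=
    fun stk hS hW hl e he => image_ne_of_word [μk, μk1] hκl hκc hκ2 hA₂ hfirst' hS hW hl he
  -- (b) no grain-2 stack frame is `A₁·Λ₀`: it would be co-axial with the bare bottom, hence the twin of `A₁·Λ₀`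
  have hfar₂ : ∀ stk : List WalkEntry, StackSound (-e₃) stk → StackWF (-e₃) stk → stk.getLast? = some ⟨A₂, u₂, 0⟩ →
      ∀ e ∈ stk, e.frame '' fccStacking 1 (Real.sqrt (2 / 3)) ≠ A₁ '' fccStacking 1 (Real.sqrt (2 / 3)) := by
    intro stk hS hW hl e he hEq
    obtain ⟨r, hS', hW', hl'⟩ := exists_suffix_of_mem stk e he hS hW
    rw [hl] at hl'
    have hco := coaxial_linear_of_image_eq (F₁ := (⟨A₁, u₁, 0⟩ : WalkEntry).frame) (F₂ := e.frame) hEq.symm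
    obtain ⟨hν, hmenu, himg, -, -⟩ := inPlaneTwin_of_coaxial_sigma9 μk μk1 hκl hκc hA₂ hfirst hsecond hcap
      hS₀ hW₀ rfl hS' hW' hl' hco
    exact image_twinFrame_ne A₁ hν hmenu (himg.symm.trans hEq)
  -- (c) the priced cross pairs
  have hledger := twoSlabAdhesion_stackLedger_cross hs₀ hcert (doubleStarCoaxialAt_of_starPairFar hfar)
    (capPairCoaxial_of_starPairFar hfar) A₁ t₁ A₂ t₂ hu₁ hsteep₁ hu₂ hsteep₂ hfar₁ hfar₂
    (fun stk₁ stk₂ e₁ e₂ rest₁ rest₂ hS₁ hW₁ hl₁ hst₁ hS₂ hW₂ hl₂ hst₂ => by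
      by_cases hco : ∃ (L : EuclideanSpace ℝ (Fin 3) ≃ₗᵢ[ℝ] EuclideanSpace ℝ (Fin 3))
          (s₁ s₂ : EuclideanSpace ℝ (Fin 3)) (σ σ' : ℤ → ℤ), IsHaggSeq σ ∧ IsHaggSeq σ' ∧
          e₁.frame '' fccStacking 1 (Real.sqrt (2 / 3)) ⊆ (fun p => L p + s₁) '' barlowStacking 1 (Real.sqrt (2 / 3)) σ ∧
          e₂.frame '' fccStacking 1 (Real.sqrt (2 / 3)) ⊆ (fun p => L p + s₂) '' barlowStacking 1 (Real.sqrt (2 / 3)) σ'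
      · right
        subst hst₁; subst hst₂
        obtain ⟨hν, hmenu, himg, hd₁, hd₂⟩ := inPlaneTwin_of_coaxial_sigma9 μk μk1 hκl hκc hA₂ hfirst hsecond hcap
          hS₁ hW₁ hl₁ hS₂ hW₂ hl₂ hco
        intro Y hY y hy hown₁ hown₂
        exact ⟨starSet_ne_of_inPlaneTwin hν hmenu himg hS₁.top.1 hd₁,
          cover_of_inPlaneTwinStarPair htw hY hν hmenu himg hS₁.top.1 hS₂.top.1 hd₁ hd₂ hy hown₁ hown₂⟩
      · exact Or.inl hco)
  -- (d) the skeleton composition and the charge `½(κ₁ + κ₂) ≥ 1`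
  have hκ₁ := one_le_flux_of_steep (A := A₁) (u := u₁) (le_trans hsteep₁ (le_abs_self _))
  have hκ₂ : 1 ≤ Real.sqrt 2 * |⟪A₂ u₂, EuclideanSpace.single (2 : Fin 3) (1 : ℝ)⟫_ℝ| := by
    refine one_le_flux_of_steep (A := A₂) (u := u₂) ?_
    rw [abs_of_nonpos (by linarith only [hsteep₂, Real.sqrt_nonneg 2] :
      ⟪A₂ u₂, EuclideanSpace.single (2 : Fin 3) (1 : ℝ)⟫_ℝ ≤ 0)]
    linarith only [hsteep₂]
  exact genericWallFloorAtCharge_mono (by linarith only [hκ₁, hκ₂])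
    (genericWallFloorAtCharge_of_ledger _ A₁ t₁ A₂ t₂ hledger)

end Summit.Ventures.Crystal3D.Theorems

end
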